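import Summits.Ventures.CertifiedManyBodySolver.Downfold.EmeryOrbitalWeightAxisBox
import Summits.Ventures.CertifiedManyBodySolver.Downfold.EmeryScaleBoxLa214X015Pts
import Summits.Ventures.CertifiedManyBodySolver.Downfold.EmeryScaleBoxLa214DFTX015Pts
import Summits.Ventures.CertifiedManyBodySolver.Downfold.EmeryScaleBoxLa214SOLX015Pts
import HarnessLib

/-!
# THE UNIVERSAL FERMI-SURFACE Cu-d WEIGHT CEILING OVER THE TYPED La₂CuO₄ BOX #18 (`emeryBoxLa214v123`) AND ITS TWO Δ_pd LEVEL-TAG SUB-BOXES AT x = 0.15 (ν = 17/40; column M16, the OPTIMAL-DOPING column)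
# — every Bloch state of every member's Fermi surface, whatever the topology (INFL-3to1-B §B.94; kernel `EmeryOrbitalWeightAxisBox` §4; companion of `EmeryBoxesLa214WeightCeiling` x ∈ {0, 1/8, 0.22})

Venture CertifiedManyBodySolver, cell `pub/hubbard-downfold` (stage S1), seat hubbard-downfold-mod-4 (technique B, g42); namespace `Summit.Ventures.CertifiedManyBodySolver.Downfold.Emery`. Everything PROVED (0 sorry).
DEVICE: `w_d(k) ≤ w_axis(ε_F)` at every zone Fermi point, `w_axis` ↓ in ε under the two-energy margin and ↑ in Δ, ↓ in t_pd, ↑ in t_pp′ ⇒ ONE corner `dWeightAxisCF(Δ₂, a₁, c₂; E_l)` bounds the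
whole box, `E_l` = the landed lower Fermi-energy bracket at `(Δ₂, a₁, b₁, c₂)` (`EmeryScaleBox<Tag><X>Pts`).
WHAT THIS IS NOT: a statement about La₂₋ₓSrₓCuO₄ x = 0.15 (column M16 of box #18) — the typed box and its Δ_pd level tags are SCREENING-GRADE; `U = 0` one-body kinematics of the σ model; no U number; not a phase word. Generator: doping-g42/prod/gen_col.py (= facebox-g38/inst/gen_ceiling.py logic).

Sources: three-band model [HybertsenSchluterChristensen1989, Eq. (1)]; [AndersenEtAl1995, §6]; [folklore] algebra.
-/

noncomputable section

namespace Summit.Ventures.CertifiedManyBodySolver.Downfold.Emery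

open Real Set

/-- **`emeryBoxLa214v123 (whole Δ_pd hull [1.7, 4.0])`, x = 0.15 (ν = 17/40): EVERY Fermi-surface Bloch state of EVERY member has Cu-d weight `≤ 0.833`** — the axis-weight ceiling at the corner
`(Δ₂, a₁, c₂) = (4.0, 1.29, 0.15)` and the box's bottom Fermi energy `E_l = 1.1534` (brackets `scalePt_La214X015_FL_br` / `scalePt_La214X015_TP_br`); any Fermi-surface topology. [folklore] -/
theorem la214ALLBox_dWeightFS_le_x015 {Δ a b c x y : ℝ} (hΔ : Δ ∈ Icc ((17 : ℝ) / 10) (4 : ℝ)) (ha : a ∈ Icc ((129 : ℝ) / 100) ((38 : ℝ) / 25)) (hb : b ∈ Icc ((23 : ℝ) / 50) ((33 : ℝ) / 50)) (hc : c ∈ Icc ((3 : ℝ) / 25) ((3 : ℝ) / 20)) (hx : x ∈ Icc (0 : ℝ) 1) (hy : y ∈ Icc (0 : ℝ) 1)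
    (hP : charCubic Δ a b c x y (fermiEnergyOf Δ a b c ((17 : ℝ) / 40)) = 0) :
    dWeight Δ a b c x y (fermiEnergyOf Δ a b c ((17 : ℝ) / 40)) ≤ ((833 : ℝ) / 1000) := by
  have hF := (fermiEnergyOf_of_pointBracketCheck scalePt_La214X015_FL_br (by norm_num) (by norm_num) (by norm_num) (ν := (17/40 : ℝ)) (by push_cast; exact ⟨le_rfl, le_rfl⟩)).2
  have hT := (fermiEnergyOf_of_pointBracketCheck scalePt_La214X015_TP_br (by norm_num) (by norm_num) (by norm_num) (ν := (17/40 : ℝ)) (by push_cast; exact ⟨le_rfl, le_rfl⟩)).2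
  push_cast at hF hT
  exact dWeight_le_of_mem_box_axis' (El := ((5767 : ℝ) / 5000)) (Eh := ((22317 : ℝ) / 10000)) (by norm_num) (by norm_num) (by norm_num) (by norm_num) (by norm_num) hΔ ha hb hc
    (by norm_num) (by norm_num) (by norm_num) hF.1 hT.2 (by norm_num) (by norm_num) (by norm_num) (by norm_num [dWeightAxisCF]) hx hy hP

/-- **`emeryBoxLa214v123 ∩ {Δ_pd ∈ [1.7, 2.91]} (DFT-level Δ tag)`, x = 0.15 (ν = 17/40): EVERY Fermi-surface Bloch state of EVERY member has Cu-d weight `≤ 0.7805`** — the axis-weight ceiling at the corner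
`(Δ₂, a₁, c₂) = (2.91, 1.29, 0.15)` and the box's bottom Fermi energy `E_l = 1.3766` (brackets `scalePt_La214DFTX015_FL_br` / `scalePt_La214DFTX015_TP_br`); any Fermi-surface topology. [folklore] -/
theorem la214DFTBox_dWeightFS_le_x015 {Δ a b c x y : ℝ} (hΔ : Δ ∈ Icc ((17 : ℝ) / 10) ((291 : ℝ) / 100)) (ha : a ∈ Icc ((129 : ℝ) / 100) ((38 : ℝ) / 25)) (hb : b ∈ Icc ((23 : ℝ) / 50) ((33 : ℝ) / 50)) (hc : c ∈ Icc ((3 : ℝ) / 25) ((3 : ℝ) / 20)) (hx : x ∈ Icc (0 : ℝ) 1) (hy : y ∈ Icc (0 : ℝ) 1)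
    (hP : charCubic Δ a b c x y (fermiEnergyOf Δ a b c ((17 : ℝ) / 40)) = 0) :
    dWeight Δ a b c x y (fermiEnergyOf Δ a b c ((17 : ℝ) / 40)) ≤ ((1561 : ℝ) / 2000) := by
  have hF := (fermiEnergyOf_of_pointBracketCheck scalePt_La214DFTX015_FL_br (by norm_num) (by norm_num) (by norm_num) (ν := (17/40 : ℝ)) (by push_cast; exact ⟨le_rfl, le_rfl⟩)).2
  have hT := (fermiEnergyOf_of_pointBracketCheck scalePt_La214DFTX015_TP_br (by norm_num) (by norm_num) (by norm_num) (ν := (17/40 : ℝ)) (by push_cast; exact ⟨le_rfl, le_rfl⟩)).2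
  push_cast at hF hT
  exact dWeight_le_of_mem_box_axis' (El := ((6883 : ℝ) / 5000)) (Eh := ((22317 : ℝ) / 10000)) (by norm_num) (by norm_num) (by norm_num) (by norm_num) (by norm_num) hΔ ha hb hc
    (by norm_num) (by norm_num) (by norm_num) hF.1 hT.2 (by norm_num) (by norm_num) (by norm_num) (by norm_num [dWeightAxisCF]) hx hy hP

/-- **`emeryBoxLa214v123 ∩ {Δ_pd ∈ [3.24, 4.0]} (solver-level Δ tag)`, x = 0.15 (ν = 17/40): EVERY Fermi-surface Bloch state of EVERY member has Cu-d weight `≤ 0.833`** — the axis-weight ceiling at the corner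
`(Δ₂, a₁, c₂) = (4.0, 1.29, 0.15)` and the box's bottom Fermi energy `E_l = 1.1534` (brackets `scalePt_La214SOLX015_FL_br` / `scalePt_La214SOLX015_TP_br`); any Fermi-surface topology. [folklore] -/
theorem la214SOLBox_dWeightFS_le_x015 {Δ a b c x y : ℝ} (hΔ : Δ ∈ Icc ((81 : ℝ) / 25) (4 : ℝ)) (ha : a ∈ Icc ((129 : ℝ) / 100) ((38 : ℝ) / 25)) (hb : b ∈ Icc ((23 : ℝ) / 50) ((33 : ℝ) / 50)) (hc : c ∈ Icc ((3 : ℝ) / 25) ((3 : ℝ) / 20)) (hx : x ∈ Icc (0 : ℝ) 1) (hy : y ∈ Icc (0 : ℝ) 1)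
    (hP : charCubic Δ a b c x y (fermiEnergyOf Δ a b c ((17 : ℝ) / 40)) = 0) :
    dWeight Δ a b c x y (fermiEnergyOf Δ a b c ((17 : ℝ) / 40)) ≤ ((833 : ℝ) / 1000) := by
  have hF := (fermiEnergyOf_of_pointBracketCheck scalePt_La214SOLX015_FL_br (by norm_num) (by norm_num) (by norm_num) (ν := (17/40 : ℝ)) (by push_cast; exact ⟨le_rfl, le_rfl⟩)).2
  have hT := (fermiEnergyOf_of_pointBracketCheck scalePt_La214SOLX015_TP_br (by norm_num) (by norm_num) (by norm_num) (ν := (17/40 : ℝ)) (by push_cast; exact ⟨le_rfl, le_rfl⟩)).2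
  push_cast at hF hT
  exact dWeight_le_of_mem_box_axis' (El := ((5767 : ℝ) / 5000)) (Eh := ((697 : ℝ) / 400)) (by norm_num) (by norm_num) (by norm_num) (by norm_num) (by norm_num) hΔ ha hb hc
    (by norm_num) (by norm_num) (by norm_num) hF.1 hT.2 (by norm_num) (by norm_num) (by norm_num) (by norm_num [dWeightAxisCF]) hx hy hP

end Summit.Ventures.CertifiedManyBodySolver.Downfold.Emery
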